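import Summits.QuantumFields.BalabanUV.T4Continuum.Support.ShellMeasurePlaquetteCubicFrozenBlock
import Summits.QuantumFields.BalabanUV.T4Continuum.Support.ShellMeasurePlaquetteCubicLocatedDichWitness

/-!
# `T4Continuum.ShellMeasurePlaquetteCubicFrozenBox` — row S77 f7 (R9): THE FROZEN BOX IN EVERY DIMENSION AT SYMBOLIC `η` —
# part 7's block (P4) binder `prop4Hyp_pinned_ord₃_eta_levels_frozen_block` FIRED on a nonempty block of ANY `d ≥ 1` and
# ANY `0 < η ≤ 1` (referee NE7c PASS 22, open item «live-level (`d = 4`, `η < 1`) example for R6∕R7: not shipped»)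
(cell `pub-balaban`, sub-cell `t4`, spine estimate NE7c (node U5b); NE7c ROUND-2 crew, unit
`b2b-balaban-t4-ne7c-formalise-leaf-02` gen 10; journal OFFER l.19686 («S77 f7 R9∕R10»); ADDITIVE — imports part 7
`ShellMeasurePlaquetteCubicFrozenBlock` (R7) and part 4 `ShellMeasurePlaquetteCubicLocatedDichWitness` (R4: `hDv_unit_of_flat`)
ONLY; [folklore]; data `def`s only (`boxΛ`, `boxBd`, `starPl`, `inclOf`, `boxU`, `boxB₀` — a letter box, geometric boundary
words, the union of stars, the inclusion of the moving bonds, the trivial background, the torus pin), 0 `def … : Prop`, 0 sorry,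
0 citation tags)

HONEST FRAMING.  Finite four-torus programme, rung (B)+1 only — NOT infinite volume, NOT a mass gap, NOT the Clay problem,
NOT summit progress; (B), `BetaPertHyp`, (B^μ) are not consumed.  NE7c (`T4IndicatorShell.ShellWeightBound`) is NOT PRINTED
in [Balaban 1983–89] and NOT PROVED; «NE7c ⇐ the named binders» (trigger c3).  A WITNESS (rule G-1) for the geometric∕weight
binders of part 7's block (P4) END at a general dimension and a SYMBOLIC fine scale — nothing printed is asserted, no estimate of
Bałaban's is discharged; which bonds move and which letters are frozen at what value is node O's ([dict]).  HONEST DEPENDENCY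
(cell): continuum YM on T⁴ ⇐ BetaPertH ∧ nine spine estimates (0/9 proved); BetaPertH ⇐ (D1) ∧ (D4) ∧ CAP+tail; G-an2-4 gates
asym, D1 and NE2/3/4.

THE POINT.  Part 6 (`ShellMeasurePlaquetteCubicFrozenWitness.toy_frozen_fires`) witnessed part 5's frozen-boundary END on the
`[-1,2]²` box at `η = 1` with `hst` by `decide` — a `d = 2`-bound certificate; the referee's reading (PASS 22 (i)) asks for
the LIVE-level instance `d = 4`, `η < 1`, and (ii) for the BLOCK form (part 7) that END-II's `hW` consumes.  THIS FILE, for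
every `d`:
* §1 the letters `boxΛ d` := ALL bonds based in the box `[-1,2]^d`; the moving bonds ANY `mv` ⊆ bonds based in `[0,1]^d`
  (`inclOf`); the plaquettes `starPl mv := ⋃_{c ∈ mv} plaqStar c` — so the owner's `hst` holds BY CONSTRUCTION
  (`star_hst`), every plaquette of `starPl mv` is increasing (`star_hincr`, from the star's shape) and based in `[-1,1]^d`
  (`inner_of_mem_starPl`), whence the geometric boundary words `boxBd` have their four letters in the box (`star_hbd`,
  `star_hor`); a FROZEN letter READ by the functional exists already for the one-bond block (`frozen_letter_read`, `d ≥ 2`);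
* §2 the analytic binders at SYMBOLIC `η` for the trivial background `boxU ≡ 1`: flatness `box_hreg` (every `η`), the
  `∇`-datum domination `box_hDv` for `covD (boxΛ d) η 1` (f5b `norm_covDerivFwd_ext_le` at symbolic `η`, read with unit
  weights by part 4's `hDv_unit_of_flat`);
* §3 **`box_frozen_block_fires`**: part 7's `prop4Hyp_pinned_ord₃_eta_levels_frozen_block` APPLIED — letters `boxΛ d`,
  plaquettes `starPl mv`, words `boxBd`, moving bonds `inclOf` (injective), `U₀ ≡ 1`, unit weights, `Lc = 1`, `ε = 1∕4`,
  `ε₀ = 0`, torus pin `T = 3` at `boxB₀`, `δ′ = 0`, ANY complete normed algebra with a tracial `τ`, **EVERY `d ≥ 1` and EVERY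
  `0 < η ≤ 1`**: `Prop4Hyp (block functional) M (1∕8)` with the ORIGINAL stencil constant; `box_frozen_block_fires_le` the
  same with the constant majorised by the clean `‖τ‖·(72(d−1)(3d+2)d + 427d)`.  At `d = 4`, `η = L^{−j}` this is the
  live-level instance; R10 (`ShellMeasureLandauEndAssembledBlockP4`) wires it AS the `hW` of the most-assembled END.
Nothing in the countdown moves; NE7c NOT PROVED; spine PROVED 0∕9.
-/

noncomputable section

open scoped BigOperators

namespace Summit.QuantumFields.BalabanUV.T4Continuum.ShellMeasurePlaquetteCubicFrozenBox

open Literature.MathematicalPhysics.QuantumFieldTheory.Balaban1983to89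
open B7Prop1Explicit (e e_apply U1)
open B8Ineq132 (covDerivFwd)
open B11Prop6Scheme (Prop4Hyp)
open TreeLengthTorus (TPt proj)
open ShellMeasureWilsonGradientTail (plaqWord bonds)
open ShellMeasurePlaquetteTwist (plaqFunSym)
open ShellMeasureLocalGradientTailJet (ord₃)
open Summit.QuantumFields.BalabanUV.T4Continuum.ShellMeasureCommutatorVariation (plaqStar)
open Summit.QuantumFields.BalabanUV.T4Continuum.ShellMeasureCommutatorGradientLocal (baseSites nbhdSites)
open Summit.QuantumFields.BalabanUV.T4Continuum.ShellMeasureCommutatorLocGrad (ext)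
open Summit.QuantumFields.BalabanUV.T4Continuum.ShellMeasureCommutatorCovDatum
  (covIdx covD unitW unitW_apply norm_covDerivFwd_ext_le)
open Summit.QuantumFields.BalabanUV.T4Continuum.ShellMeasureLocalGradientTail (locGrad)
open Summit.QuantumFields.BalabanUV.T4Continuum.ShellMeasureMultiGridNorms (WSup)
open Summit.QuantumFields.BalabanUV.T4Continuum.ShellMeasureMultiGridNormsMax (WMax Prop4Hyp.mono)
open Summit.QuantumFields.BalabanUV.T4Continuum.ShellMeasurePinnedNorm (pinW pinDist)
open Summit.QuantumFields.BalabanUV.T4Continuum.ShellMeasureWilsonRemainderLevels (etaScale)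
open Summit.QuantumFields.BalabanUV.T4Continuum.ShellMeasurePlaquetteCubicDictionary (plaqWord_zero_eq)
open Summit.QuantumFields.BalabanUV.T4Continuum.ShellMeasurePlaquetteCubicLocatedDichWitness (hDv_unit_of_flat)
open Summit.QuantumFields.BalabanUV.T4Continuum.ShellMeasurePlaquetteCubicFrozenBlock
  (extZ prop4Hyp_pinned_ord₃_eta_levels_frozen_block)

export B7Prop1Explicit (Site)

variable {d : ℕ}

/-! ## §1 The letters, the moving bonds, the plaquettes, the boundary words — every dimension -/

/-- THE LETTERS: every bond based in the box `[-1,2]^d`. [folklore] -/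
def boxΛ (d : ℕ) : Finset (Site d × Fin d) :=
  (Fintype.piFinset fun _ : Fin d => Finset.Icc (-1 : ℤ) 2) ×ˢ (Finset.univ : Finset (Fin d))

/-- Membership in the letter set is a coordinate condition. [folklore] -/
theorem mem_boxΛ_iff {x : Site d} {μ : Fin d} : (x, μ) ∈ boxΛ d ↔ ∀ i, -1 ≤ x i ∧ x i ≤ 2 := by
  simp [boxΛ, Fintype.mem_piFinset]

/-- A site of the inner box `[-1,1]^d` carries letters. [folklore] -/
theorem mem_boxΛ_of_inner {x : Site d} (hx : ∀ i, -1 ≤ x i ∧ x i ≤ 1) (μ : Fin d) : (x, μ) ∈ boxΛ d :=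
  mem_boxΛ_iff.2 fun i => ⟨(hx i).1, by linarith [(hx i).2]⟩

/-- The coordinates of `e_ν` are `0` or `1`. [folklore] -/
theorem e_apply_zero_or_one (ν i : Fin d) : (e ν : Site d) i = 0 ∨ (e ν : Site d) i = 1 := by
  rw [e_apply]; split_ifs <;> simp

/-- … and so do their unit translates. [folklore] -/
theorem add_e_mem_boxΛ_of_inner {x : Site d} (hx : ∀ i, -1 ≤ x i ∧ x i ≤ 1) (ν μ : Fin d) : (x + e ν, μ) ∈ boxΛ d := by
  refine mem_boxΛ_iff.2 fun i => ?_
  obtain ⟨h1, h2⟩ := hx i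
  rcases e_apply_zero_or_one ν i with h | h <;> simp only [Pi.add_apply, h] <;> constructor <;> linarith

/-- THE BOUNDARY WORDS: for a plaquette `p_{μν}(x)` based in the inner box, the geometric word `∂p` with letters in `boxΛ d`
oriented `(+,+,−,−)`; elsewhere a junk word (never read: `starPl` is based in the inner box). [folklore] -/
def boxBd [NeZero d] (p : Fin d × Fin d × Site d) : Fin 4 → ↥(boxΛ d) × Bool :=
  if hx : ∀ i, -1 ≤ p.2.2 i ∧ p.2.2 i ≤ 1 then
    ![(⟨(p.2.2, p.1), mem_boxΛ_of_inner hx p.1⟩, true), (⟨(p.2.2 + e p.1, p.2.1), add_e_mem_boxΛ_of_inner hx p.1 p.2.1⟩, true),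
      (⟨(p.2.2 + e p.2.1, p.1), add_e_mem_boxΛ_of_inner hx p.2.1 p.1⟩, false),
      (⟨(p.2.2, p.2.1), mem_boxΛ_of_inner hx p.2.1⟩, false)]
  else
    ![(⟨((0 : Site d), (0 : Fin d)), mem_boxΛ_of_inner (fun _ => by simp) 0⟩, true),
      (⟨((0 : Site d), (0 : Fin d)), mem_boxΛ_of_inner (fun _ => by simp) 0⟩, true),
      (⟨((0 : Site d), (0 : Fin d)), mem_boxΛ_of_inner (fun _ => by simp) 0⟩, false),
      (⟨((0 : Site d), (0 : Fin d)), mem_boxΛ_of_inner (fun _ => by simp) 0⟩, false)]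

/-- On inner-based plaquettes the boundary word is the geometric one. [folklore] -/
theorem boxBd_of_inner [NeZero d] {p : Fin d × Fin d × Site d} (hx : ∀ i, -1 ≤ p.2.2 i ∧ p.2.2 i ≤ 1) :
    boxBd p = ![(⟨(p.2.2, p.1), mem_boxΛ_of_inner hx p.1⟩, true),
      (⟨(p.2.2 + e p.1, p.2.1), add_e_mem_boxΛ_of_inner hx p.1 p.2.1⟩, true),
      (⟨(p.2.2 + e p.2.1, p.1), add_e_mem_boxΛ_of_inner hx p.2.1 p.1⟩, false),
      (⟨(p.2.2, p.2.1), mem_boxΛ_of_inner hx p.2.1⟩, false)] := by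
  unfold boxBd
  rw [dif_pos hx]

/-- THE PLAQUETTES: the union of the full stars of the moving bonds. [folklore] -/
def starPl (mv : Finset (Site d × Fin d)) : Finset (Fin d × Fin d × Site d) := mv.biUnion fun c => plaqStar c.1 c.2

/-- Unfolding of the star: the four families. [folklore] -/
theorem mem_plaqStar_iff {y : Site d} {κ : Fin d} {p : Fin d × Fin d × Site d} :
    p ∈ plaqStar y κ ↔ (∃ ν, κ < ν ∧ ((κ, ν, y) = p ∨ (κ, ν, y - e ν) = p)) ∨
      (∃ μ, μ < κ ∧ ((μ, κ, y - e μ) = p ∨ (μ, κ, y) = p)) := by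
  simp only [plaqStar, Finset.mem_union, Finset.mem_image, Finset.mem_Ioi, Finset.mem_Iio]
  constructor
  · rintro ((⟨ν, hν, h⟩ | ⟨ν, hν, h⟩) | (⟨μ, hμ, h⟩ | ⟨μ, hμ, h⟩))
    · exact Or.inl ⟨ν, hν, Or.inl h⟩
    · exact Or.inl ⟨ν, hν, Or.inr h⟩
    · exact Or.inr ⟨μ, hμ, Or.inl h⟩
    · exact Or.inr ⟨μ, hμ, Or.inr h⟩
  · rintro (⟨ν, hν, h | h⟩ | ⟨μ, hμ, h | h⟩)
    · exact Or.inl (Or.inl ⟨ν, hν, h⟩)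
    · exact Or.inl (Or.inr ⟨ν, hν, h⟩)
    · exact Or.inr (Or.inl ⟨μ, hμ, h⟩)
    · exact Or.inr (Or.inr ⟨μ, hμ, h⟩)

/-- Every plaquette of a star is increasing. [folklore] -/
theorem incr_of_mem_plaqStar {y : Site d} {κ : Fin d} {p : Fin d × Fin d × Site d} (hp : p ∈ plaqStar y κ) :
    p.1 < p.2.1 := by
  rcases mem_plaqStar_iff.1 hp with ⟨ν, hν, h | h⟩ | ⟨μ, hμ, h | h⟩ <;> subst h
  exacts [hν, hν, hμ, hμ]

/-- Every plaquette of the star of a bond based at `y` is based at `y` or at `y − e_λ`. [folklore] -/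
theorem base_of_mem_plaqStar {y : Site d} {κ : Fin d} {p : Fin d × Fin d × Site d} (hp : p ∈ plaqStar y κ) :
    p.2.2 = y ∨ ∃ l : Fin d, p.2.2 = y - e l := by
  rcases mem_plaqStar_iff.1 hp with ⟨ν, hν, h | h⟩ | ⟨μ, hμ, h | h⟩ <;> subst h
  · exact Or.inl rfl
  · exact Or.inr ⟨ν, rfl⟩
  · exact Or.inr ⟨μ, rfl⟩
  · exact Or.inl rfl

/-- `starPl` is increasing. [folklore] -/
theorem star_hincr (mv : Finset (Site d × Fin d)) : ∀ p ∈ starPl mv, p.1 < p.2.1 := by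
  intro p hp
  obtain ⟨c, -, hc⟩ := Finset.mem_biUnion.1 hp
  exact incr_of_mem_plaqStar hc

/-- A plaquette of the star of a bond based in `[0,1]^d` is based in the inner box `[-1,1]^d`. [folklore] -/
theorem inner_of_mem_starPl {mv : Finset (Site d × Fin d)} (hmv : ∀ b ∈ mv, ∀ i, 0 ≤ b.1 i ∧ b.1 i ≤ 1)
    {p : Fin d × Fin d × Site d} (hp : p ∈ starPl mv) : ∀ i, -1 ≤ p.2.2 i ∧ p.2.2 i ≤ 1 := by
  obtain ⟨c, hc, hpc⟩ := Finset.mem_biUnion.1 hp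
  intro i
  obtain ⟨h0, h1⟩ := hmv c hc i
  rcases base_of_mem_plaqStar hpc with h | ⟨l, h⟩
  · rw [h]; exact ⟨by linarith, h1⟩
  · rw [h, Pi.sub_apply]
    rcases e_apply_zero_or_one l i with h' | h' <;> rw [h'] <;> constructor <;> linarith

/-- `boxBd p = ∂p` on `starPl mv`. [folklore] -/
theorem star_hbd [NeZero d] {mv : Finset (Site d × Fin d)} (hmv : ∀ b ∈ mv, ∀ i, 0 ≤ b.1 i ∧ b.1 i ≤ 1) :
    ∀ p ∈ starPl mv, ((boxBd p 0).1 : Site d × Fin d) = (p.2.2, p.1)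
      ∧ ((boxBd p 1).1 : Site d × Fin d) = (p.2.2 + e p.1, p.2.1)
      ∧ ((boxBd p 2).1 : Site d × Fin d) = (p.2.2 + e p.2.1, p.1) ∧ ((boxBd p 3).1 : Site d × Fin d) = (p.2.2, p.2.1) := by
  intro p hp
  rw [boxBd_of_inner (inner_of_mem_starPl hmv hp)]
  simp

/-- The orientations `(+,+,−,−)` on `starPl mv`. [folklore] -/
theorem star_hor [NeZero d] {mv : Finset (Site d × Fin d)} (hmv : ∀ b ∈ mv, ∀ i, 0 ≤ b.1 i ∧ b.1 i ≤ 1) :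
    ∀ p ∈ starPl mv, (boxBd p 0).2 = true ∧ (boxBd p 1).2 = true ∧ (boxBd p 2).2 = false ∧ (boxBd p 3).2 = false := by
  intro p hp
  rw [boxBd_of_inner (inner_of_mem_starPl hmv hp)]
  simp

/-- Bonds based in `[0,1]^d` are letters. [folklore] -/
theorem subset_boxΛ_of_unit {mv : Finset (Site d × Fin d)} (hmv : ∀ b ∈ mv, ∀ i, 0 ≤ b.1 i ∧ b.1 i ≤ 1) :
    mv ⊆ boxΛ d := by
  rintro ⟨x, μ⟩ hb
  exact mem_boxΛ_iff.2 fun i => ⟨by linarith [(hmv _ hb i).1], by linarith [(hmv _ hb i).2]⟩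

/-- THE INCLUSION of the moving bonds among the letters (along a proof of `mv ⊆ boxΛ d`). [folklore] -/
def inclOf {mv : Finset (Site d × Fin d)} (h : mv ⊆ boxΛ d) (c : ↥mv) : ↥(boxΛ d) := ⟨c.1, h c.2⟩

/-- `inclOf` is the identity on underlying bonds. [folklore] -/
@[simp] theorem coe_inclOf {mv : Finset (Site d × Fin d)} (h : mv ⊆ boxΛ d) (c : ↥mv) :
    ((inclOf h c : ↥(boxΛ d)) : Site d × Fin d) = c := rfl

/-- `inclOf` is injective. [folklore] -/
theorem inclOf_injective {mv : Finset (Site d × Fin d)} (h : mv ⊆ boxΛ d) : Function.Injective (inclOf h) :=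
  fun _ _ hab => Subtype.ext (congrArg (fun x : ↥(boxΛ d) => (x : Site d × Fin d)) hab)

/-- **THE OWNER'S `hst` HOLDS BY CONSTRUCTION: the full star of every moving bond lies in `starPl mv`.** [folklore] -/
theorem star_hst {mv : Finset (Site d × Fin d)} (h : mv ⊆ boxΛ d) :
    ∀ c : ↥mv, plaqStar (inclOf h c).1.1 (inclOf h c).1.2 ⊆ starPl mv := by
  rintro ⟨c, hc⟩
  exact Finset.subset_biUnion_of_mem (fun c : Site d × Fin d => plaqStar c.1 c.2) hc

/-- THE ONE-BOND BLOCK `{(0, 0)}` is based in `[0,1]^d`. [folklore] -/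
theorem unit_of_singleton_zero [NeZero d] :
    ∀ b ∈ ({((0 : Site d), (0 : Fin d))} : Finset (Site d × Fin d)), ∀ i, 0 ≤ b.1 i ∧ b.1 i ≤ 1 := by
  intro b hb i
  rw [Finset.mem_singleton] at hb
  subst hb
  simp

/-- **A FROZEN LETTER READ BY THE FUNCTIONAL** (`d ≥ 2`, one-bond block `{(0,0)}`): the plaquette `p_{01}(−e₁)` lies in the
star of the moving bond `(0, 0)`, and its first boundary letter `(−e₁, 0)` is a letter of the box that does NOT move.
[folklore] -/
theorem frozen_letter_read [NeZero d] (h1 : (0 : Fin d) < 1) :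
    ((0 : Fin d), (1 : Fin d), (0 : Site d) - e 1) ∈ starPl ({((0 : Site d), (0 : Fin d))} : Finset (Site d × Fin d))
      ∧ ((0 : Site d) - e 1, (0 : Fin d)) ∈ boxΛ d
      ∧ ((0 : Site d) - e 1, (0 : Fin d)) ∉ ({((0 : Site d), (0 : Fin d))} : Finset (Site d × Fin d)) := by
  refine ⟨?_, ?_, ?_⟩
  · rw [starPl, Finset.singleton_biUnion]
    exact mem_plaqStar_iff.2 (Or.inl ⟨1, h1, Or.inr rfl⟩)
  · refine mem_boxΛ_iff.2 fun i => ?_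
    rcases e_apply_zero_or_one (1 : Fin d) i with h | h <;> simp [h]
  · rw [Finset.mem_singleton, Prod.mk.injEq, not_and']
    intro _ h
    have h' := congrArg (fun v : Site d => v 1) h
    simp [e_apply] at h'

/-! ## §2 The analytic binders at SYMBOLIC `η` for the trivial background -/

/-- The trivial background `U₀ ≡ 1` on `ℤᵈ`. [folklore] -/
def boxU (𝔸 : Type*) [Monoid 𝔸] (d : ℕ) : Site d → Fin d → 𝔸ˣ := fun _ _ => 1

/-- The torus pin centre: the image of the origin on `(ℤ∕3)^d`. [folklore] -/
def boxB₀ (d : ℕ) : Finset (TPt d 3) := {proj 3 (0 : Site d)}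

/-- [folklore] -/
theorem boxB₀_nonempty : (boxB₀ d).Nonempty := Finset.singleton_nonempty _

section Fires

variable {𝔸 : Type*} [NormedRing 𝔸] [NormOneClass 𝔸] [NormedAlgebra ℂ 𝔸] [CompleteSpace 𝔸] (τ : 𝔸 →L[ℂ] ℂ)

omit [NormedAlgebra ℂ 𝔸] [CompleteSpace 𝔸] in
/-- `U₀ ≡ 1 ∈ U1`. [folklore] -/
theorem box_h₀ : ∀ (y : Site d) (κ : Fin d), boxU 𝔸 d y κ ∈ U1 𝔸 := fun _ _ => (U1 𝔸).one_mem

omit [NormOneClass 𝔸] in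
/-- `U₀ ≡ 1` is flat on every plaquette of `starPl mv` — at EVERY `η` (flatness budget `ε₀ = 0`). [folklore] -/
theorem box_hreg [NeZero d] {mv : Finset (Site d × Fin d)} (hmv : ∀ b ∈ mv, ∀ i, 0 ≤ b.1 i ∧ b.1 i ≤ 1) (η : ℝ) :
    ∀ p ∈ starPl mv,
      ‖(plaqWord (fun b : ↥(boxΛ d) => boxU 𝔸 d b.1.1 b.1.2) (boxBd p) (0 : ↥(boxΛ d) → 𝔸) : 𝔸) - 1‖
        ≤ 0 * (η / unitW (Fin d × Fin d × Site d) p) ^ 2 := by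
  intro p hp
  obtain ⟨h0, h1, h2, h3⟩ := star_hor hmv p hp
  rw [plaqWord_zero_eq (fun b : ↥(boxΛ d) => boxU 𝔸 d b.1.1 b.1.2) (boxBd p) h0 h1 h2 h3]
  simp [boxU]

omit [NormOneClass 𝔸] [CompleteSpace 𝔸] in
/-- ∇-DATUM DOMINATION AT SYMBOLIC `η` for `covD (boxΛ d) η 1` with unit weights, read at the moving bonds (f5b
`norm_covDerivFwd_ext_le` through part 4's `hDv_unit_of_flat`). [folklore] -/
theorem box_hDv {mv : Finset (Site d × Fin d)} (h : mv ⊆ boxΛ d) (η : ℝ) (A : ↥(boxΛ d) → 𝔸) (c : ↥mv) (x : Site d)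
    (κ' τ' : Fin d) (hx : x ∈ baseSites (inclOf h c).1.1) :
    unitW ↥(boxΛ d) (inclOf h c) ^ 2 * ‖covDerivFwd η (boxU 𝔸 d) κ' (fun z => ext (boxΛ d) A z τ') x‖ ≤
      ‖(WSup.toPiL (unitW ↥(covIdx (boxΛ d))) 2).symm (covD (𝔸 := 𝔸) (boxΛ d) η (boxU 𝔸 d) A)‖ :=
  hDv_unit_of_flat (boxΛ d) (covD (𝔸 := 𝔸) (boxΛ d) η (boxU 𝔸 d))
    (fun A y κ τ => norm_covDerivFwd_ext_le (boxΛ d) η (boxU 𝔸 d) A y κ τ) A (inclOf h c) x κ' τ' hx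

/-! ## §3 Part 7's block (P4) binder FIRED — every `d ≥ 1`, every `0 < η ≤ 1` -/

/-- **THE BLOCK (P4) BINDER FIRES ON THE FROZEN BOX IN EVERY DIMENSION AT SYMBOLIC `η`.**  Part 7's
`prop4Hyp_pinned_ord₃_eta_levels_frozen_block` APPLIED: letters `boxΛ d` (ALL bonds based in `[-1,2]^d`), moving bonds ANY
`mv` ⊆ bonds based in `[0,1]^d` through the injective `inclOf`, plaquettes `starPl mv` (the union of the full stars — `hst` by
construction), geometric boundary words `boxBd` (`hbd`∕`hor`), `U₀ ≡ 1` (`h₀`, `hreg` with `ε₀ = 0`), unit weights `wt = wd =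
Wf = Wd = W ≡ 1` (`hWf`∕`hcf`∕`hcd`∕`hWw`∕`hwW` trivially, `hηW` = `η ≤ 1`), `Lc = 1`, the ∇-datum `covD (boxΛ d) η 1` with its
domination (`box_hDv`), `ε = 1∕4`, torus pin `T = 3` at `boxB₀ d`, `δ′ = 0`, any complete normed algebra with a tracial `τ`,
ANY `1 ≤ d` and ANY `0 < η ≤ 1` — EVERY hypothesis discharged in kernel: the block functional
`Yb ↦ (c ↦ locGrad (etaScale η (Σ_{p ∈ starPl mv} ord₃ plaqFunSym_p)) (extZ Yb) (inclOf c))` on the block field space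
`WMax (1·pin ∘ inclOf) 1 (covD ∘L extZ)` satisfies `Prop4Hyp (·) M (1∕8)` with the ORIGINAL stencil constant `M` (`e^{0·2}`
kept literal).  At `d = 4`, `η = L^{−j} < 1` this is the live-level instance of referee PASS 22 (i). [folklore] -/
theorem box_frozen_block_fires [NeZero d] (hd1 : 1 ≤ d) {mv : Finset (Site d × Fin d)}
    (hmv : ∀ b ∈ mv, ∀ i, 0 ≤ b.1 i ∧ b.1 i ≤ 1) (htr : ∀ P Q : 𝔸, τ (P * Q) = τ (Q * P))
    {η : ℝ} (hη : 0 < η) (hη1 : η ≤ 1) :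
    Prop4Hyp (fun Yb : WMax (fun c : ↥mv => unitW ↥(boxΛ d) (inclOf (subset_boxΛ_of_unit hmv) c) *
          pinW 0 (pinDist (boxB₀ d) boxB₀_nonempty ∘ fun c : ↥mv => proj 3 (inclOf (subset_boxΛ_of_unit hmv) c).1.1) c)
        (unitW ↥(covIdx (boxΛ d)))
        ((covD (𝔸 := 𝔸) (boxΛ d) η (boxU 𝔸 d)).comp (extZ (inclOf (subset_boxΛ_of_unit hmv)))) =>
        ((WSup.toPiL (fun c : ↥mv => unitW ↥(boxΛ d) (inclOf (subset_boxΛ_of_unit hmv) c) ^ 3 *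
            pinW 0 (pinDist (boxB₀ d) boxB₀_nonempty ∘
              fun c : ↥mv => proj 3 (inclOf (subset_boxΛ_of_unit hmv) c).1.1) c) 1).symm
          (fun c : ↥mv => locGrad (etaScale η (fun A : ↥(boxΛ d) → 𝔸 =>
              ∑ p ∈ starPl mv, ord₃ (plaqFunSym τ (fun b : ↥(boxΛ d) => boxU 𝔸 d b.1.1 b.1.2) (boxBd p)) A))
            (WMax.toPiL (fun b => unitW ↥(boxΛ d) b *
                pinW 0 (pinDist (boxB₀ d) boxB₀_nonempty ∘ fun b : ↥(boxΛ d) => proj 3 b.1.1) b)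
              (unitW ↥(covIdx (boxΛ d))) (covD (𝔸 := 𝔸) (boxΛ d) η (boxU 𝔸 d))
              ((WMax.toPiL (fun b => unitW ↥(boxΛ d) b *
                  pinW 0 (pinDist (boxB₀ d) boxB₀_nonempty ∘ fun b : ↥(boxΛ d) => proj 3 b.1.1) b)
                (unitW ↥(covIdx (boxΛ d))) (covD (𝔸 := 𝔸) (boxΛ d) η (boxU 𝔸 d))).symm
                (extZ (inclOf (subset_boxΛ_of_unit hmv)) (WMax.toPiL
                  (fun c : ↥mv => unitW ↥(boxΛ d) (inclOf (subset_boxΛ_of_unit hmv) c) *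
                    pinW 0 (pinDist (boxB₀ d) boxB₀_nonempty ∘
                      fun c : ↥mv => proj 3 (inclOf (subset_boxΛ_of_unit hmv) c).1.1) c)
                  (unitW ↥(covIdx (boxΛ d)))
                  ((covD (𝔸 := 𝔸) (boxΛ d) η (boxU 𝔸 d)).comp (extZ (inclOf (subset_boxΛ_of_unit hmv)))) Yb))))
            (inclOf (subset_boxΛ_of_unit hmv) c)) :
          WSup (fun c : ↥mv => unitW ↥(boxΛ d) (inclOf (subset_boxΛ_of_unit hmv) c) ^ 3 *
            pinW 0 (pinDist (boxB₀ d) boxB₀_nonempty ∘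
              fun c : ↥mv => proj 3 (inclOf (subset_boxΛ_of_unit hmv) c).1.1) c) 1 (𝔸 →L[ℂ] ℂ)))
      (((72 * ((d : ℝ) - 1) * ‖τ‖ * (1 : ℝ) ^ 3) * ((3 * d + 2) * d : ℕ)
          + 8 * (‖τ‖ * (248 / 3 * (0 : ℝ) + 40 / 3 * (1 / 4 : ℝ))) * (1 : ℝ) ^ 4 * (4 * (4 * d : ℕ))) * Real.exp (0 * 2))
      ((1 / 4 : ℝ) / 2) :=
  prop4Hyp_pinned_ord₃_eta_levels_frozen_block (boxΛ d) (starPl mv) τ box_h₀ boxBd (unitW ↥(boxΛ d))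
    (unitW ↥(covIdx (boxΛ d))) (covD (𝔸 := 𝔸) (boxΛ d) η (boxU 𝔸 d)) (unitW ↥(boxΛ d)) (unitW ↥(boxΛ d))
    (unitW (Fin d × Fin d × Site d)) (inclOf (subset_boxΛ_of_unit hmv)) (inclOf_injective _) hη htr (star_hincr mv) le_rfl
    (star_hst _) (star_hbd hmv) (star_hor hmv) (fun _ => one_pos) (fun _ _ _ => le_rfl) (fun _ => by simp) (fun _ => by simp)
    (box_hDv (𝔸 := 𝔸) (subset_boxΛ_of_unit hmv) η) (by norm_num) le_rfl (by norm_num)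
    (fun _ _ => by simpa [unitW] using hη1) (fun _ _ _ _ => le_rfl) (fun _ _ _ _ => by simp) (box_hreg (𝔸 := 𝔸) hmv η)
    hd1 (boxB₀ d) boxB₀_nonempty le_rfl

/-- **… WITH THE CONSTANT CLEANED**: the same block (P4) binder with `M ≤ ‖τ‖·(72(d−1)(3d+2)d + 427d)` and radius `1∕8`
(f2c `Prop4Hyp.mono`; `8·(40∕3·¼)·16 = 1280∕3 ≤ 427`, `e^{0} = 1`). [folklore] -/
theorem box_frozen_block_fires_le [NeZero d] (hd1 : 1 ≤ d) {mv : Finset (Site d × Fin d)}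
    (hmv : ∀ b ∈ mv, ∀ i, 0 ≤ b.1 i ∧ b.1 i ≤ 1) (htr : ∀ P Q : 𝔸, τ (P * Q) = τ (Q * P))
    {η : ℝ} (hη : 0 < η) (hη1 : η ≤ 1) :
    Prop4Hyp (fun Yb : WMax (fun c : ↥mv => unitW ↥(boxΛ d) (inclOf (subset_boxΛ_of_unit hmv) c) *
          pinW 0 (pinDist (boxB₀ d) boxB₀_nonempty ∘ fun c : ↥mv => proj 3 (inclOf (subset_boxΛ_of_unit hmv) c).1.1) c)
        (unitW ↥(covIdx (boxΛ d)))
        ((covD (𝔸 := 𝔸) (boxΛ d) η (boxU 𝔸 d)).comp (extZ (inclOf (subset_boxΛ_of_unit hmv)))) =>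
        ((WSup.toPiL (fun c : ↥mv => unitW ↥(boxΛ d) (inclOf (subset_boxΛ_of_unit hmv) c) ^ 3 *
            pinW 0 (pinDist (boxB₀ d) boxB₀_nonempty ∘
              fun c : ↥mv => proj 3 (inclOf (subset_boxΛ_of_unit hmv) c).1.1) c) 1).symm
          (fun c : ↥mv => locGrad (etaScale η (fun A : ↥(boxΛ d) → 𝔸 =>
              ∑ p ∈ starPl mv, ord₃ (plaqFunSym τ (fun b : ↥(boxΛ d) => boxU 𝔸 d b.1.1 b.1.2) (boxBd p)) A))
            (WMax.toPiL (fun b => unitW ↥(boxΛ d) b *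
                pinW 0 (pinDist (boxB₀ d) boxB₀_nonempty ∘ fun b : ↥(boxΛ d) => proj 3 b.1.1) b)
              (unitW ↥(covIdx (boxΛ d))) (covD (𝔸 := 𝔸) (boxΛ d) η (boxU 𝔸 d))
              ((WMax.toPiL (fun b => unitW ↥(boxΛ d) b *
                  pinW 0 (pinDist (boxB₀ d) boxB₀_nonempty ∘ fun b : ↥(boxΛ d) => proj 3 b.1.1) b)
                (unitW ↥(covIdx (boxΛ d))) (covD (𝔸 := 𝔸) (boxΛ d) η (boxU 𝔸 d))).symm
                (extZ (inclOf (subset_boxΛ_of_unit hmv)) (WMax.toPiL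
                  (fun c : ↥mv => unitW ↥(boxΛ d) (inclOf (subset_boxΛ_of_unit hmv) c) *
                    pinW 0 (pinDist (boxB₀ d) boxB₀_nonempty ∘
                      fun c : ↥mv => proj 3 (inclOf (subset_boxΛ_of_unit hmv) c).1.1) c)
                  (unitW ↥(covIdx (boxΛ d)))
                  ((covD (𝔸 := 𝔸) (boxΛ d) η (boxU 𝔸 d)).comp (extZ (inclOf (subset_boxΛ_of_unit hmv)))) Yb))))
            (inclOf (subset_boxΛ_of_unit hmv) c)) :
          WSup (fun c : ↥mv => unitW ↥(boxΛ d) (inclOf (subset_boxΛ_of_unit hmv) c) ^ 3 *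
            pinW 0 (pinDist (boxB₀ d) boxB₀_nonempty ∘
              fun c : ↥mv => proj 3 (inclOf (subset_boxΛ_of_unit hmv) c).1.1) c) 1 (𝔸 →L[ℂ] ℂ)))
      (‖τ‖ * (72 * ((d : ℝ) - 1) * ((3 * d + 2) * d) + 427 * d)) (1 / 8) := by
  refine Prop4Hyp.mono (box_frozen_block_fires τ hd1 hmv htr hη hη1) ?_ (by norm_num)
  have hd : (1 : ℝ) ≤ d := by exact_mod_cast hd1
  have hτ : 0 ≤ ‖τ‖ := norm_nonneg _
  rw [zero_mul, Real.exp_zero, mul_one]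
  push_cast
  nlinarith [mul_nonneg hτ (by linarith : (0 : ℝ) ≤ d)]

/-- **THE LIVE-LEVEL INSTANCE, LITERALLY** (referee PASS 22 (i): `d = 4`, `η < 1`): the one-bond block `{(0,0)}` in the
`[-1,2]⁴` box at `η = 1∕2` — `Prop4Hyp (block functional) (‖τ‖·(72·3·14·4 + 427·4)) (1∕8)`. [folklore] -/
example (htr : ∀ P Q : 𝔸, τ (P * Q) = τ (Q * P)) :=
  box_frozen_block_fires_le (d := 4) τ (by norm_num) unit_of_singleton_zero htr (η := 1 / 2) (by norm_num) (by norm_num)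

end Fires

end Summit.QuantumFields.BalabanUV.T4Continuum.ShellMeasurePlaquetteCubicFrozenBox

end
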